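import Literature.IUT.HodgeTheaters.ProfiniteCompletionFiniteIndexIso
import Mathlib.GroupTheory.Coprod.Basic
import Mathlib.GroupTheory.FreeGroup.Basic
import Mathlib.GroupTheory.Solvable
import Mathlib.GroupTheory.OrderOfElement
import Mathlib.GroupTheory.Perm.Basic
import HarnessLib

/-!
# Basis permutations of a free profinite group — the candidate statements (PBF)/(PBF₀)/(PBF-cyclic)/(PBF-prime)
# (all PROVED in this packet), `permHat`, `clGen`, and the retraction onto a finite free factor

Background citations (statement shapes; NOTHING here is a hypothesis): W. Herfort, L. Ribes, *Solvable subgroups of free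
products of profinite groups*, in: Group Theory (Singapore 1987), de Gruyter 1989, pp. 391–403 — Lemma 1.1 (held span
l.144), Theorem 2.6 (a) (held span l.192–194; galaxy-panama 257320080637994) [cite: HerfortRibes1989, Lemma 1.1 (pp. 391–403, held span l.144)];
profinite completions [cite: RibesZalesskii2010, §3.2]; free factors of free profinite products are malnormal
[cite: RibesZalesskii2010, Thm. 9.1.12].  v2/v3 (abc-iut-w6-d081 GEN 24): the two Herfort–Ribes 1989 facts are NO LONGER hypotheses anywhere in this packet — their only point of use, the centraliser of a prime-order free factor in `(A ∗ B)^`, is PROVED Kurosh-free in `FreeProfinitePermBasisCentralizer.lean` (wreath retraction); Herfort–Ribes 1985/1989 and Ribes–Zalesskii Thm. 9.1.12 remain CITATIONS for the statement shapes.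

For FINITE groups `A`, `B`, `profiniteCompletion (Monoid.Coprod A B)` IS their free profinite product (coproduct in the
category of profinite groups, Herfort–Ribes 1989 §1): `Hom_cont((A ∗ B)^, H) ≅ Hom(A ∗ B, H) ≅ Hom(A,H) × Hom(B,H)` for
profinite `H`, by `ProfiniteGrp.ProfiniteCompletion.lift`/`lift_unique` and the universal property of `Monoid.Coprod`.

CONTENTS. §0 generic completion vocabulary (`shadow`, `mapHat`).  §2 `permHat σ` (a basis permutation acting on
`F̂(S) := profiniteCompletion (FreeGroup S)`) and the candidate statements `PermBasisFixedPoints` (PBF),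
`PermBasisFixedPointsFree` (PBF₀) — `Prop` definitions, NOT asserted here; they are PROVED (no hypotheses) in
`FreeProfinitePermBasisFree.lean` / `FreeProfinitePermBasisPrime.lean` (`permBasisFixedPointsFree_holds`,
`permBasisFixedPoints_holds`).  §3 THEOREMS: the retraction `(A ∗ B)^ → Â` onto a finite free factor and its
consequences (`η ∘ inl` injective for finite `A`; a conjugate of `η(inl a)`, `a ≠ 1`, never lies in `η(inr B)`).
§4 `clGen Y = cl⟨Y⟩`, the intermediate statements `PermBasisFixedPointsCyclic` / `PermBasisFixedPointsPrime` (PROVED in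
`FreeProfinitePermBasisEmbedding.lean` / `…Prime.lean`), continuity of `permHat`.  §5 `permAut`.  This is the DEFINITIONS
file of the ROUTE-PBF P-chain; the T-chain (abc-iut-L6-t19, `SettingModelBTorsionTower*`) imports it and consumes
`PermBasisFixedPoints.{0}` BY NAME (interface ruling §F v1.19gu (A): names, namespace, `Type u` unchanged).

HONEST FRAMING. Classical profinite group theory (free profinite groups as completions of free groups, free profinite
products of finite groups as completions of free products); theorems only, no named-fact hypothesis; the four candidate `Prop`s of
`FreeProfinitePermBasis.lean` are all PROVED in this packet (`_holds`); no (E)-class module and no `SettingModel*` file is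
imported; nothing of [EtTh]/[IUTchII]/[IUTchIII] in print is asserted; CELL hextΔ/hΘ UNDECIDED-AT-MODEL; no side is taken on
[IUTchIII] Cor. 3.12; nothing here says abc is proved or refuted.  abc-iut cell, programme P-L2, rung (L3′), ROUTE-PBF,
P-chain (seat abc-iut-w6-d081 GEN 23; v3 GEN 24); desk: PL3-TREEFREE (abc-iut-L6-t19 g22) + PL3-PBF-READ (this seat).
-/

noncomputable section

namespace Literature.AnabelianGeometry.EtaleTheta.SettingModel.TreeFree

open CategoryTheory Topology
open Literature.IUT.HodgeTheaters (profiniteCompletion toCompletion)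

universe u


/-! ### §0 Generic completion vocabulary used by the P-chain: shadows and completed homomorphisms -/

section Generic0

variable {D E : Type u} [Group D] [Group E]

/-- shadow [cite: RibesZalesskii2010, §3.2] -/
def shadow (M : FiniteIndexNormalSubgroup D) (x : profiniteCompletion D) : D ⧸ M.toSubgroup := x.val M

/-- the completed homomorphism `φ̂ : D̂ → Ê` of a discrete `φ : D →* E` [cite: RibesZalesskii2010, §3.2] -/
abbrev mapHat (φ : D →* E) : profiniteCompletion D →* profiniteCompletion E :=
  (ProfiniteGrp.profiniteCompletion.map (GrpCat.ofHom φ)).hom.toMonoidHom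

end Generic0



/-! ### §2 Basis permutations of a free profinite group; the candidate statements (PBF), (PBF₀) -/

/-- The continuous endomorphism of the free profinite group `F̂(S)` (profinite completion of `FreeGroup S`)
induced by a permutation `σ` of the basis `S`: functoriality of the completion applied to `FreeGroup.map σ`.
(Verbatim from abc-iut-L6-t19's statements file.)  Statement of the ROUTE-PBF P-chain (this packet); cf. Ribes–Zalesskii, *Profinite Groups*, §3.2. [cite: RibesZalesskii2010, §3.2] -/
def permHat {S : Type u} (σ : Equiv.Perm S) :
    profiniteCompletion (FreeGroup S) →* profiniteCompletion (FreeGroup S) :=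
  (ProfiniteGrp.profiniteCompletion.map
    (GrpCat.ofHom (FreeGroup.map σ : FreeGroup S →* FreeGroup S))).hom.toMonoidHom

/-- `permHat σ` extends the basis permutation: on the dense image `η(FreeGroup S)` it is `FreeGroup.map σ`
(Mathlib `ProfiniteGrp.ProfiniteCompletion.lift_eta`). [cite: RibesZalesskii2010, §3.2] -/
theorem permHat_toCompletion {S : Type u} (σ : Equiv.Perm S) (w : FreeGroup S) :
    permHat σ (toCompletion (FreeGroup S) w) = toCompletion (FreeGroup S) (FreeGroup.map σ w) :=
  ConcreteCategory.congr_hom (ProfiniteGrp.ProfiniteCompletion.lift_eta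
    (GrpCat.ofHom (FreeGroup.map σ : FreeGroup S →* FreeGroup S) ≫
      ProfiniteGrp.ProfiniteCompletion.eta (GrpCat.of (FreeGroup S)))) w

/-- `permHat` is multiplicative in the permutation on the dense image (so `σ ↦ permHat σ` is an action of any
`Q ≤ Perm S` there). [cite: RibesZalesskii2010, §3.2] -/
theorem permHat_mul_toCompletion {S : Type u} (σ τ : Equiv.Perm S) (w : FreeGroup S) :
    permHat (σ * τ) (toCompletion (FreeGroup S) w) = permHat σ (permHat τ (toCompletion (FreeGroup S) w)) := by
  simp only [permHat_toCompletion, Equiv.Perm.coe_mul, FreeGroup.map.comp]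

/-- **(PBF)** — fixed points of basis permutations are generated by the fixed letters: for a group `Q` of
permutations of the finite set `S`, an element of `F̂(S)` fixed by every `permHat σ`, `σ ∈ Q`, lies in the
closure of (the image of) the subgroup of `FreeGroup S` generated by the letters fixed by `Q`.  The candidate
THEOREM of ROUTE-PBF (`permBasisFixedPoints_holds`, file `…Prime.lean`); here a `Prop` definition, NOT asserted.
(Verbatim from abc-iut-L6-t19's statements file.)  Statement of the ROUTE-PBF P-chain (this packet); cf. Ribes–Zalesskii, *Profinite Groups*, §3.2. [cite: RibesZalesskii2010, §3.2] -/
def PermBasisFixedPoints : Prop :=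
  ∀ (S : Type u) [Fintype S] (Q : Subgroup (Equiv.Perm S)) (w : profiniteCompletion (FreeGroup S)),
    (∀ σ ∈ Q, permHat σ w = w) →
      w ∈ closure (toCompletion (FreeGroup S) ''
        (Subgroup.closure (FreeGroup.of '' {s : S | ∀ σ ∈ Q, σ s = s}) : Set (FreeGroup S)))

/-- **(PBF₀)** — the load-bearing special case: a fixed-point-FREE permutation of PRIME order of the finite basis
`S` fixes no element `≠ 1` of `F̂(S)`.  A `Prop` definition, NOT asserted here (PROVED: `permBasisFixedPointsFree_holds`, file `…Free.lean`).
(Verbatim from abc-iut-L6-t19's statements file.)  Statement of the ROUTE-PBF P-chain (this packet); cf. Ribes–Zalesskii, *Profinite Groups*, §3.2. [cite: RibesZalesskii2010, §3.2] -/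
def PermBasisFixedPointsFree : Prop :=
  ∀ (S : Type u) [Fintype S] (σ : Equiv.Perm S) (p : ℕ), p.Prime → σ ^ p = 1 → (∀ s, σ s ≠ s) →
    ∀ w : profiniteCompletion (FreeGroup S), permHat σ w = w → w = 1

/-! ### §3 The retraction onto a finite free factor (THEOREMS) -/

section Retract

variable (A B : Type u) [Group A] [Group B]

/-- The retraction `r : (A ∗ B)^ → Â` onto the first free factor: the completion of `Monoid.Coprod.lift id 1`
(identity on `A`, trivial on `B`). [cite: RibesZalesskii2010, §9.1] -/
def retractLeft : profiniteCompletion (Monoid.Coprod A B) →* profiniteCompletion A :=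
  (ProfiniteGrp.profiniteCompletion.map
    (GrpCat.ofHom (Monoid.Coprod.lift (MonoidHom.id A) (1 : B →* A)))).hom.toMonoidHom

/-- `r` on the dense image: `r (η x) = η_A (lift id 1 x)`. [cite: RibesZalesskii2010, §3.2] -/
theorem retractLeft_toCompletion (x : Monoid.Coprod A B) :
    retractLeft A B (toCompletion (Monoid.Coprod A B) x) =
      toCompletion A (Monoid.Coprod.lift (MonoidHom.id A) (1 : B →* A) x) :=
  Literature.IUT.HodgeTheaters.ProfiniteCompletion.profiniteCompletionMap_toCompletion _ x

/-- `r (η (inl a)) = η_A a`. [cite: RibesZalesskii2010, §3.2] -/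
@[simp] theorem retractLeft_toCompletion_inl (a : A) :
    retractLeft A B (toCompletion (Monoid.Coprod A B) (Monoid.Coprod.inl a)) = toCompletion A a := by
  rw [retractLeft_toCompletion]; simp

/-- `r (η (inr b)) = 1`. [cite: RibesZalesskii2010, §3.2] -/
@[simp] theorem retractLeft_toCompletion_inr (b : B) :
    retractLeft A B (toCompletion (Monoid.Coprod A B) (Monoid.Coprod.inr b)) = 1 := by
  rw [retractLeft_toCompletion]; simp

variable {A B}

/-- For a FINITE group `A` (hence residually finite), `η_A : A → Â` is injective. [cite: RibesZalesskii2010, §3.2] -/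
theorem toCompletion_injective_of_finite [Finite A] : Function.Injective (toCompletion A) :=
  (ProfiniteGrp.ProfiniteCompletion.etaFn_injective_iff_residuallyFinite (GrpCat.of A)).mpr
    (inferInstanceAs (Group.ResiduallyFinite A))

/-- For finite `A`, `η ∘ inl : A → (A ∗ B)^` is injective (the retraction is a left inverse up to `η_A`). [cite: RibesZalesskii2010, §3.2] -/
theorem toCompletion_inl_injective [Finite A] :
    Function.Injective (toCompletion (Monoid.Coprod A B) ∘ (Monoid.Coprod.inl : A →* Monoid.Coprod A B)) := by
  intro a₁ a₂ h
  have h' := congrArg (retractLeft A B) h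
  simp only [Function.comp_apply, retractLeft_toCompletion_inl] at h'
  exact toCompletion_injective_of_finite h'

/-- For finite `A` and `a ≠ 1`: `η (inl a) ≠ 1` in `(A ∗ B)^`. [cite: RibesZalesskii2010, §3.2] -/
theorem toCompletion_inl_ne_one [Finite A] {a : A} (ha : a ≠ 1) :
    toCompletion (Monoid.Coprod A B) (Monoid.Coprod.inl a) ≠ 1 := by
  intro h
  apply ha
  apply toCompletion_inl_injective (A := A) (B := B)
  simpa using h

/-- For finite `A` and `a ≠ 1`, NO conjugate of `η (inl a)` lies in `η (inr B)`: apply the retraction `r`, which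
kills `η(inr B)` and is injective on `η(inl A)`. [cite: RibesZalesskii2010, §3.2] -/
theorem conj_toCompletion_inl_notMem_range_inr [Finite A] {a : A} (ha : a ≠ 1)
    (g : profiniteCompletion (Monoid.Coprod A B)) :
    g * toCompletion (Monoid.Coprod A B) (Monoid.Coprod.inl a) * g⁻¹ ∉
      Set.range (toCompletion (Monoid.Coprod A B) ∘ (Monoid.Coprod.inr : B →* Monoid.Coprod A B)) := by
  rintro ⟨b, hb⟩
  have h := congrArg (retractLeft A B) hb
  simp only [Function.comp_apply, retractLeft_toCompletion_inr, map_mul, map_inv,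
    retractLeft_toCompletion_inl] at h
  -- h : 1 = r g * η_A a * (r g)⁻¹
  have h1 : toCompletion A a = 1 := by
    have h2 : retractLeft A B g * toCompletion A a * (retractLeft A B g)⁻¹ = 1 := h.symm
    rw [mul_inv_eq_one] at h2
    simpa using h2
  exact ha (toCompletion_injective_of_finite (by simpa using h1))

end Retract

/-! ### §5 Basis permutations as automorphisms of the free group -/

section PermAut

variable {S : Type u}

/-- A permutation of the basis as an automorphism of the free group (`FreeGroup.freeGroupCongr`), as a
homomorphism `Perm S →* MulAut (FreeGroup S)`. [cite: RibesZalesskii2010, §3.2] -/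
def permAut : Equiv.Perm S →* MulAut (FreeGroup S) where
  toFun τ := FreeGroup.freeGroupCongr τ
  map_one' := by
    ext x
    simp
  map_mul' σ τ := by
    ext x
    simp [MulAut.mul_apply, FreeGroup.map.comp, Equiv.Perm.coe_mul]

/-- `permAut τ` acts as `FreeGroup.map τ`. [cite: RibesZalesskii2010, §3.2] -/
@[simp] theorem permAut_apply (τ : Equiv.Perm S) (x : FreeGroup S) : permAut τ x = FreeGroup.map τ x := rfl

/-- `(permAut τ).toMonoidHom = FreeGroup.map τ`. [cite: RibesZalesskii2010, §3.2] -/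
theorem permAut_toMonoidHom (τ : Equiv.Perm S) :
    (permAut τ).toMonoidHom = FreeGroup.map τ := MonoidHom.ext fun _ => rfl

end PermAut

/-! ### §4 `clGen` and the intermediate candidate statements (cyclic / prime exponent); continuity of `permHat` -/

section Candidates

variable {S : Type u}

/-- The closure in `F̂(S)` of the image of the subgroup of `FreeGroup S` generated by the letters `Y`:
`clGen Y = cl⟨Y⟩`. (An abbreviation for the SET written out in `PermBasisFixedPoints`.) [cite: RibesZalesskii2010, §3.2] -/
abbrev clGen (Y : Set S) : Set (profiniteCompletion (FreeGroup S)) :=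
  closure (toCompletion (FreeGroup S) '' (Subgroup.closure (FreeGroup.of '' Y) : Set (FreeGroup S)))

/-- **(PBF) for cyclic groups**: an element fixed by ONE basis permutation `σ` lies in `clGen (S^σ)`.
A `Prop` definition; NOT asserted here (PROVED in files `…Embedding`/`…Prime`).  Statement of the ROUTE-PBF P-chain (this packet); cf. Ribes–Zalesskii, *Profinite Groups*, §3.2. [cite: RibesZalesskii2010, §3.2] -/
def PermBasisFixedPointsCyclic : Prop :=
  ∀ (S : Type u) [Fintype S] (σ : Equiv.Perm S) (w : profiniteCompletion (FreeGroup S)),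
    permHat σ w = w → w ∈ clGen {s : S | σ s = s}

/-- **(PBF) at prime exponent**: an element fixed by a basis permutation `σ` with `σ ^ q = 1`, `q` prime, lies in
`clGen (S^σ)`.  A `Prop` definition; NOT asserted here (PROVED from (PBF₀) by the P-tower, file `…Prime`).  Statement of the ROUTE-PBF P-chain (this packet); cf. Ribes–Zalesskii, *Profinite Groups*, §3.2. [cite: RibesZalesskii2010, §3.2] -/
def PermBasisFixedPointsPrime : Prop :=
  ∀ (S : Type u) [Fintype S] (σ : Equiv.Perm S) (q : ℕ), q.Prime → σ ^ q = 1 →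
    ∀ w : profiniteCompletion (FreeGroup S), permHat σ w = w → w ∈ clGen {s : S | σ s = s}

/-- `permHat` is continuous. [cite: RibesZalesskii2010, §3.2] -/
theorem continuous_permHat (σ : Equiv.Perm S) : Continuous (permHat σ) :=
  (ProfiniteGrp.profiniteCompletion.map
    (GrpCat.ofHom (FreeGroup.map σ : FreeGroup S →* FreeGroup S))).hom.continuous_toFun

end Candidates

end Literature.AnabelianGeometry.EtaleTheta.SettingModel.TreeFree

end
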